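import Literature.Geometry.Symplectic.PuncturedDiscClosedOneForm
import HarnessLib

/-!
# `2π`-periodic functions of the angle are smooth functions on the punctured plane

Topic `Literature/Geometry/Symplectic`; proofs file (layer "averaging along the circle orbits")
of the fact seat of `Literature.Geometry.Symplectic.mclean_divisorComplement_convex_four`
(M. McLean, *The growth rate of symplectic homology and affine varieties*, GAFA 22 (2012),
Lemma 5.17), bridging `Literature/Analysis/FunctionSpaces/PeriodicPrimitive.lean` (a smooth
`2π`-periodic solution `H (q, t)` of `∂ₜ H = G - ⟨G⟩`) to the fibres of the tube of the divisor
(punctured discs): a smooth function of parameters and of the ANGLE, `2π`-periodic in the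
angle, defines a smooth function `(q, z) ↦ H (q, arg z)` on `Q × (ℂ ∖ {0})`, whose derivative
along the rotation `s ↦ z e^{is}` is `∂ₜ H (q, arg z)` (McLean 2012, proof of Lemma 5.17: the
fibrewise correction `f''` on `US ∖ S`; McDuff–Salamon 2017, §5.5).

* `apply_eq_of_coe_angle_eq` — a `2π`-periodic `H (q, ·)` takes equal values at real numbers
  with the same class in `Real.Angle`;
* `apply_arg_neg_add_pi`, `apply_arg_mul_exp` — hence `H (q, arg (-z) + π) = H (q, arg z)` and
  `H (q, arg (z e^{is})) = H (q, arg z + s)` (`z ≠ 0`);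
* `contDiffAt_comp_arg_of_periodic` — **`(q, z) ↦ H (q, arg z)` is `C^∞` at every `(q, z)`,
  `z ≠ 0`** (on the slit plane `arg` is smooth; on the opposite slit plane the function agrees
  with `H (q, arg (-z) + π)`);
* `hasDerivAt_comp_arg_mul_exp` — **`d/ds H (q, arg (z e^{is})) = ∂ₜ H (q, arg z + s)`**.

Everything is proved; no definitions, no named facts (D-0026).

## References

* M. McLean, *The growth rate of symplectic homology and affine varieties*, Geom. Funct. Anal. 22
  (2012), proof of Lemma 5.17. [Mclean2012]
* D. McDuff, D. Salamon, *Introduction to Symplectic Topology*, 3rd ed. (2017), §5.5.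
  [McDuffSalamon2017]
-/

noncomputable section

open scoped Topology ContDiff Real
open Set Filter Complex

namespace Literature.Geometry.Symplectic

open Literature.Topology.FourManifolds (contDiffAt_arg)

variable {Q : Type*} [NormedAddCommGroup Q] [NormedSpace ℝ Q]

/-! ### Periodicity bookkeeping -/

omit [NormedAddCommGroup Q] [NormedSpace ℝ Q] in
/-- A `2π`-periodic function takes the same value at reals with the same class in `ℝ/2πℤ`.
[folklore] -/
theorem apply_eq_of_coe_angle_eq {H : Q × ℝ → ℝ} (hper : ∀ q t, H (q, t + 2 * π) = H (q, t))
    (q : Q) {a b : ℝ} (h : (a : Real.Angle) = b) : H (q, a) = H (q, b) := by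
  obtain ⟨k, hk⟩ := Real.Angle.angle_eq_iff_two_pi_dvd_sub.1 h
  have hp : Function.Periodic (fun t ↦ H (q, t)) (2 * π) := fun t ↦ hper q t
  have hab : a = b + k * (2 * π) := by linarith
  rw [hab]
  exact hp.int_mul k b

omit [NormedAddCommGroup Q] [NormedSpace ℝ Q] in
/-- `H (q, arg (-z) + π) = H (q, arg z)` for `z ≠ 0` and `2π`-periodic `H (q, ·)` (the two
angle branches differ by a multiple of `2π`). [folklore] -/
theorem apply_arg_neg_add_pi {H : Q × ℝ → ℝ} (hper : ∀ q t, H (q, t + 2 * π) = H (q, t))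
    (q : Q) {z : ℂ} (hz : z ≠ 0) : H (q, arg (-z) + π) = H (q, arg z) := by
  refine apply_eq_of_coe_angle_eq hper q ?_
  rw [Real.Angle.coe_add, arg_neg_coe_angle hz, add_assoc, ← Real.Angle.coe_add,
    show (π + π : ℝ) = 2 * π by ring, Real.Angle.coe_two_pi, add_zero]

omit [NormedAddCommGroup Q] [NormedSpace ℝ Q] in
/-- **Rotation shifts the angle**: `H (q, arg (z e^{is})) = H (q, arg z + s)` for `z ≠ 0` and
`2π`-periodic `H (q, ·)`. [folklore] -/
theorem apply_arg_mul_exp {H : Q × ℝ → ℝ} (hper : ∀ q t, H (q, t + 2 * π) = H (q, t))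
    (q : Q) {z : ℂ} (hz : z ≠ 0) (s : ℝ) :
    H (q, arg (z * exp (s * I))) = H (q, arg z + s) := by
  refine apply_eq_of_coe_angle_eq hper q ?_
  rw [arg_mul_coe_angle hz (exp_ne_zero _), arg_exp_mul_I, Real.Angle.coe_toIocMod,
    Real.Angle.coe_add]

/-! ### Smoothness on the punctured plane -/

/-- **A smooth `2π`-periodic function of the angle is smooth on the punctured plane**: for
`H : Q × ℝ → ℝ` of class `C^∞` with `H (q, t + 2π) = H (q, t)`, the function
`(q, z) ↦ H (q, arg z)` is `C^∞` at every `(q, z)` with `z ≠ 0` (McLean's fibrewise correction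
read on the tube; on `ℂ ∖ (-∞, 0]` this is smoothness of `arg`, on `ℂ ∖ [0, ∞)` the function
coincides with `H (q, arg (-z) + π)`). [cite: Mclean2012, Lemma 5.17 (proof)] -/
theorem contDiffAt_comp_arg_of_periodic {H : Q × ℝ → ℝ} (hH : ContDiff ℝ ∞ H)
    (hper : ∀ q t, H (q, t + 2 * π) = H (q, t)) {q : Q} {z : ℂ} (hz : z ≠ 0) :
    ContDiffAt ℝ ∞ (fun x : Q × ℂ ↦ H (x.1, arg x.2)) (q, z) := by
  rcases mem_slitPlane_or_neg_mem_slitPlane hz with h | h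
  · have hA : ContDiffAt ℝ ∞ (fun x : Q × ℂ ↦ (x.1, arg x.2)) (q, z) :=
      contDiffAt_fst.prodMk ((contDiffAt_arg h).comp (q, z) contDiffAt_snd)
    exact hH.contDiffAt.comp (q, z) hA
  · -- on `Q × (-slitPlane)` the function is `H (q, arg (-z) + π)`
    have hO : IsOpen {x : Q × ℂ | -x.2 ∈ slitPlane} :=
      isOpen_slitPlane.preimage (continuous_neg.comp continuous_snd)
    have hev : (fun x : Q × ℂ ↦ H (x.1, arg x.2)) =ᶠ[𝓝 (q, z)]
        fun x : Q × ℂ ↦ H (x.1, arg (-x.2) + π) := by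
      filter_upwards [hO.mem_nhds (show (q, z) ∈ {x : Q × ℂ | -x.2 ∈ slitPlane} from h)] with x hx
      exact (apply_arg_neg_add_pi hper x.1 (fun h0 ↦ by
        rw [h0, neg_zero] at hx; exact slitPlane_ne_zero hx rfl)).symm
    have hA : ContDiffAt ℝ ∞ (fun x : Q × ℂ ↦ (x.1, arg (-x.2) + π)) (q, z) :=
      contDiffAt_fst.prodMk ((contDiffAt_arg_neg_add_pi h).comp (q, z) contDiffAt_snd)
    exact (hH.contDiffAt.comp (q, z) hA).congr_of_eventuallyEq hev

/-- The smooth function `(q, z) ↦ H (q, arg z)` on an open set of `Q × (ℂ ∖ {0})`.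
[folklore] -/
theorem contDiffOn_comp_arg_of_periodic {H : Q × ℝ → ℝ} (hH : ContDiff ℝ ∞ H)
    (hper : ∀ q t, H (q, t + 2 * π) = H (q, t)) {W : Set (Q × ℂ)} (hW : ∀ x ∈ W, x.2 ≠ 0) :
    ContDiffOn ℝ ∞ (fun x : Q × ℂ ↦ H (x.1, arg x.2)) W := fun x hx ↦
  (contDiffAt_comp_arg_of_periodic (q := x.1) (z := x.2) hH hper (hW x hx)).contDiffWithinAt

/-! ### The derivative along the rotation -/

/-- **`d/ds H (q, arg z + s) = ∂ₜ H (q, arg z + s)`** (chain rule; `∂ₜ H = D H (0, 1)`).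
[folklore] -/
theorem hasDerivAt_comp_add {H : Q × ℝ → ℝ} (hH : ContDiff ℝ ∞ H) (q : Q) (a s : ℝ) :
    HasDerivAt (fun s : ℝ ↦ H (q, a + s)) (fderiv ℝ H (q, a + s) ((0 : Q), (1 : ℝ))) s := by
  have h1 : HasFDerivAt H (fderiv ℝ H (q, a + s)) (q, a + s) :=
    ((hH.differentiable (by simp)) (q, a + s)).hasFDerivAt
  have h2 : HasFDerivAt (fun s : ℝ ↦ ((q, a + s) : Q × ℝ))
      ((0 : ℝ →L[ℝ] Q).prod (ContinuousLinearMap.id ℝ ℝ)) s :=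
    (hasFDerivAt_const q s).prodMk ((hasFDerivAt_id s).const_add a)
  have h3 := (h1.comp s h2).hasDerivAt
  refine h3.congr_deriv ?_
  rfl

/-- **The derivative along the rotation orbit**: for `z ≠ 0`,
`d/ds H (q, arg (z e^{is})) = ∂ₜ H (q, arg z + s)` — the function `(q, z) ↦ H (q, arg z)`
solves along the circle orbits whatever `H` solves in `t` (McLean 2012, proof of Lemma 5.17;
McDuff–Salamon 2017, §5.5). [cite: Mclean2012, Lemma 5.17 (proof)] -/
theorem hasDerivAt_comp_arg_mul_exp {H : Q × ℝ → ℝ} (hH : ContDiff ℝ ∞ H)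
    (hper : ∀ q t, H (q, t + 2 * π) = H (q, t)) (q : Q) {z : ℂ} (hz : z ≠ 0) (s : ℝ) :
    HasDerivAt (fun s : ℝ ↦ H (q, arg (z * exp (s * I))))
      (fderiv ℝ H (q, arg z + s) ((0 : Q), (1 : ℝ))) s := by
  have hfun : (fun s : ℝ ↦ H (q, arg (z * exp (s * I)))) = fun s ↦ H (q, arg z + s) :=
    funext fun s ↦ apply_arg_mul_exp hper q hz s
  rw [hfun]
  exact hasDerivAt_comp_add hH q (arg z) s

end Literature.Geometry.Symplectic
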